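import Summits.QuantumFields.YangMills.Theorems.BalabanUVNodesN20HybridClassLawBudget

/-!
# BalabanUVNodes ∕ node N20 (NE7b) — THE CLASS-LAW ROAD AND THE CHARACTERISATION: at a pinned key, with EVERY dial free, the hybrid binder list
# `∃ Bad W shA shB Wsh δ, HybridNE7 …` is EQUIVALENT to node U5's DECL target ∧ «the two runs' normalised class laws are TV-close with a summable
# radius `ρ_K < 1`»; the road needs NO bad class — the shells are the positive parts of the two-sided misfit against the target's constants

Cell `pub-ymgap` (HUMAN RULING D-0062 Track A ∕ D-0149 ∕ director-ym R399 (3a) second-wave width seats), WIDTH SEAT `pub-ymgap-dag-n20-w4` (node n20 =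
NE7b, seat w4), generation g0, CLAIM-2 ∕ INTENT-2.  Route `Summits/QuantumFields/YangMills/Theses/BalabanUVNodes.lean`, key item K3⁷ `SpineGivenEndpointR13SepCoPH`
(stmt-QuantumFields-20544; skeleton of record v5 941dddb108cbaacf, stub 2 `stub_expansion13H` :472 — faces `KeyedRelWeight` (N20), `KeyedShellWeight` (N21),
`KeyedCoreEdgeHolderD4` (N19′) at the reading pinned by `PinnedAtLive` :363); filed `--kind proof --supports … --as helper`.  COUNT-NEUTRAL.  THEOREMS ONLY
(0 `def`, 0 `instance`, 0 `sorry`).  ADDITIVE — imports this seat's `…N20HybridClassLawBudget` (p607565; through it `…N19HybridBeyondTarget`, `Spine/NE7/Targets`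
(`Core`, `Target`, `target_of_hybridNE7`), `T4CauchySum.MatchingModConstants`, `T4HybridMatching.hybridDelta`) — all CITED BY NAME; modifies nothing.

WHY.  p607565 proved the NECESSITY half with every dial free: `HybridNE7 l₀ vol T A B Bad W shA shB Wsh δ` forces the two runs' normalised laws on the class
index, `p(S) = Σ_S A ∕ Σ_T A`, `q(S) = Σ_S B ∕ Σ_T B`, to be close on every `S ⊆ T K` within the summable budget `2(W_K + Wsh_K) + 2|vol·δ_K|`.  dag-n19-w1's
`N19HybridBeyondTarget.coreEdge_iff_target_classOsc` (p602850 §4) characterised N19′'s slot AT FIXED admissible weights and shells: «DECL target ∧ `Hom` summable»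
(`Hom` = the sup-norm class-oscillation of the good cores' log-ratio).  This file is the ALL-DIALS characterisation: the sup-norm letter on GIVEN good classes
becomes a mass-weighted (L¹ ∕ total-variation) letter on the class LAWS, and the weights and shells are CONSTRUCTED.
* §1 [folklore] THE STRICT BUDGET (p607565's chain, one more line): `p(S) − q(S) ≤ 1 − (1 − W_K − Wsh_K)²·e^{−2|vol·δ_K|}` (`< 1`), hence
  ★ `exists_tvRadius_of_hybridNE7`: `∃ ρ, (∀ K, 0 ≤ ρ_K < 1) ∧ Summable ρ ∧ |p(S) − q(S)| ≤ ρ_K` on the source window.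
* §2 [folklore] ★★ THE CLASS-LAW ROAD `exists_hybridNE7_of_target_of_classLawTV`: nonnegative terms, positive totals with the E1∕E2 dictionary
  `Z K t = Σ_T A`, `Z (K+1) t = Σ_T B`, node U5's `Target vol l₀ δ Z` (constants `c_K`, radius `r_K = vol·δ_K`) and a TV radius `0 ≤ ρ_K < 1`, `Σ ρ_K < ∞`,
  `|p(S) − q(S)| ≤ ρ_K` ⇒ `∃ shA shB, HybridNE7 l₀ vol T A B (∅) (0) shA shB ρ δ` with `shB := (B − e^{c_K + r_K}·A)⁺`, `shA := (A − e^{r_K − c_K}·B)⁺`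
  (positive parts as `if … then … else 0`): on every class `e^{c_K − r_K}(A − shA) ≤ B − shB ≤ e^{c_K + r_K}(A − shA)` BY CONSTRUCTION (three cases), and
  `Σ_T shB = Σ_{S⁺}(B − e^{c+r}A) ≤ Σ_{S⁺}B − (Z_B∕Z_A)·Σ_{S⁺}A = Z_B·(q(S⁺) − p(S⁺)) ≤ ρ_K·Z_B` on `S⁺ = {e^{c+r}A < B}` since the target gives
  `Z_B∕Z_A ≤ e^{c+r}` — likewise run A.  NO bad class, core radius = the target's own `δ`.
* §3 [folklore] ★★★ `exists_hybridNE7_iff_target_and_classLawTV`: `(∃ Bad W shA shB Wsh δ, HybridNE7 …) ↔ (∃ δ, Target vol l₀ δ Z) ∧ (∃ ρ, (∀ K, 0 ≤ ρ_K < 1) ∧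
  Summable ρ ∧ TV ≤ ρ)` for nonnegative terms, positive totals, the dictionary, `0 < vol`, `0 ≤ l₀` (→ : `target_of_hybridNE7` + §1; ← : §2).

READING (for the plan ∕ CRIT ∕ the n19–n21 lanes; located, nothing proposed).  (i) At the key that v5's `PinnedAtLive` pins (`classSet₁₃ ∕ weightA₁₃ ∕ weightB₁₃`
of `crOfRecord₁₃V` on the live line; the faces apply BY NAME through dag-n20-d's transfers), stub 2's N20 ∧ N21 ∧ N19′ faces with the prover's six dials are worth
EXACTLY: node U5's DECL target at the dressed partition functions (the E1∕E2 dictionary is N27x) ∧ ONE class-law letter «the two runs' normalised laws on the keyed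
classes are TV-close with a summable radius `< 1`, uniformly on `|t| ≤ l₀`».  The irreducible two-run content of the hybrid at a pinned key is WHERE the two runs
put their mass among the classes — nothing finer (no per-class log-ratio, no `Hom`), nothing coarser (p607565: any unsummable law gap is fatal).  (ii) On this
road N20's bad-class dial is REDUNDANT (`Bad := ∅`, `W := 0`), N21's shells carry the whole content beyond the target (cf. dag-n19-w1's `…N19CutTransfer…`).
(iii) At a COARSER key `kr` (idea-3's `wkey`) the class laws are push-forwards, TV can only DROP, and both theorems apply verbatim to the fibre-summed weights.
ADJACENT (cited, not re-typed): dag-n20-w3 g5's `…N20CoreEdgeShellDial` (p608626, CLAIM 05:37Z) — the ℓ¹-OPTIMAL shells `(A − e^{−c}B)⁺ ∕ (B − e^{c}A)⁺` at ONE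
constant give `Core` at radius `0` and put the target's slack into the shell budget; §2 below uses the target's BAND `c_K ± vol·δ_K` instead (two thresholds, shell
budget exactly `ρ`, core radius `δ`); dag-n20-w5 g0's `…N20QuantisedRatioNoRescue` (p606977) §1 is the misfit NECESSITY.  The iff §3 is this seat's CLAIM-2 (05:48Z).

HONEST FRAMING.  [folklore] finite-sum ∕ real arithmetic on the tree's SHAPES (`HybridNE7`, `RelWeightBound`, `ShellWeightBound`, `Core`, `Target`, `MatchingModConstants`
as HYPOTHESES or CONSTRUCTED from hypotheses); NO estimate of the programme is proved; the TV letter and the target are produced by nobody — they ARE the two-run NE7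
content, NOT PRINTED as two-run statements for d = 4 ([Balaban1987RG1]–[Balaban1989LargeFieldII] bound ONE run; [King1986] (3.10)–(3.13) is a d = 2, 3 template) and
NOT proved; nothing of Bałaban's asserted or instantiated (no `Provisos₁₃CoPH` tuple — K0⁷ OPEN); N19 ∕ N20 ∕ N21 NOT discharged; K3⁷ OPEN, not claimed; no summit
statement is proved by this seat; counts UNMOVED (typed 28∕28 · discharged 5∕27, A 5∕28).  One finite four-torus programme at fixed ε — NOT ℝ⁴, NOT infinite volume,
NOT OS, NOT a mass gap, NOT the Clay problem (R4 closes the conditional finite-𝕋⁴ rung `BalabanLadder.UV` only).  0 `def`; 0 `sorry`; standard axioms; no cite tags.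
-/

noncomputable section

namespace Summit.QuantumFields.YangMills.BalabanUVNodes.N20HybridClassLawCharacterisation

open Finset Filter
open Summit.QuantumFields.BalabanUV.T4Continuum.Spine.NE7 (Core Target target_of_hybridNE7)
open Literature.MathematicalPhysics.QuantumFieldTheory.Balaban1983to89
open T4CauchySum (MatchingModConstants)
open T4WeightBudget (RelWeightBound)
open T4IndicatorShell (ShellWeightBound)
open T4MatchingAssembly (HybridNE7)
open T4HybridMatching (hybridDelta)
open Summit.QuantumFields.YangMills.BalabanUVNodes.N20HybridClassLawBudget
  (mul_sub_le_sum_of_goodCores exists_transports_of_hybridNE7 abs_classLaw_sub_classLaw_le_of_hybridNE7 summable_budget_of_hybridNE7)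

variable {ι : Type*} {l₀ vol : ℝ} {T : ℕ → Finset ι} {A B shA shB : ℕ → ℝ → ι → ℝ} {Bad : ℕ → ℝ → Finset ι} {W Wsh δ : ℕ → ℝ}

/-! ## §1 The strict budget: under `HybridNE7` the class laws are never mutually singular, uniformly on the window [folklore] -/
section Strict
variable [DecidableEq ι]
/-- **THE STRICT ONE-SIDED BUDGET** [folklore].  `HybridNE7 …` ⇒ for every `S ⊆ T K` at an admissible source value (positive totals):
`Σ_S A ∕ Σ_T A − Σ_S B ∕ Σ_T B ≤ 1 − (1 − W_K − Wsh_K)²·e^{−2|vol·δ_K|}` — p607565's chain (`q(S) ≥ (1−η)e^{−2x}(p(S) − η)`) read without linearising. -/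
theorem classLaw_sub_classLaw_le_one_sub_of_hybridNE7 (h : HybridNE7 l₀ vol T A B Bad W shA shB Wsh δ) (K : ℕ) {t : ℝ} (ht : |t| ≤ l₀)
    (hZA : 0 < ∑ τ ∈ T K, A K t τ) (hZB : 0 < ∑ τ ∈ T K, B K t τ) {S : Finset ι} (hS : S ⊆ T K) :
    (∑ τ ∈ S, A K t τ) / (∑ τ ∈ T K, A K t τ) - (∑ τ ∈ S, B K t τ) / (∑ τ ∈ T K, B K t τ)
      ≤ 1 - (1 - (W K + Wsh K)) ^ 2 * Real.exp (-(2 * |vol * δ K|)) := by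
  set ZA := ∑ τ ∈ T K, A K t τ with hZAdef
  set ZB := ∑ τ ∈ T K, B K t τ with hZBdef
  set a := ∑ τ ∈ S, A K t τ with hadef
  set b := ∑ τ ∈ S, B K t τ with hbdef
  set η := W K + Wsh K with hηdef
  set x := |vol * δ K| with hxdef
  have hη0 : 0 ≤ η := add_nonneg (h.weight.nonneg K) (h.shell.nonneg K)
  have hη1 : η < 1 := h.lt_one K
  obtain ⟨c, hc⟩ := exists_transports_of_hybridNE7 h K
  have hBad : Bad K t ⊆ T K := h.weight.bad_subset K t ht
  have hshA0 : ∀ τ ∈ T K, 0 ≤ shA K t τ := h.shell.sh_nonneg_left K t ht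
  have hshB0 : ∀ τ ∈ T K, 0 ≤ shB K t τ := h.shell.sh_nonneg_right K t ht
  have hshA1 : ∀ τ ∈ T K, shA K t τ ≤ A K t τ := h.shell.sh_le_left K t ht
  have hshB1 : ∀ τ ∈ T K, shB K t τ ≤ B K t τ := h.shell.sh_le_right K t ht
  have hA0 : ∀ τ ∈ T K, 0 ≤ A K t τ := fun τ hτ => (hshA0 τ hτ).trans (hshA1 τ hτ)
  have hB0 : ∀ τ ∈ T K, 0 ≤ B K t τ := fun τ hτ => (hshB0 τ hτ).trans (hshB1 τ hτ)
  have hi : Real.exp (c - x) * (a - η * ZA) ≤ b :=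
    mul_sub_le_sum_of_goodCores (Real.exp_pos _).le hS hBad hA0 hshA0 hshB0 hshB1 (h.weight.bad_left K t ht)
      (h.shell.left K t ht) (fun τ hτ => (hc t ht τ hτ).1)
  have hii : (Real.exp (c + x))⁻¹ * (ZB - η * ZB) ≤ ZA := by
    have := mul_sub_le_sum_of_goodCores (A := B) (B := A) (shA := shB) (shB := shA) (W := W) (Wsh := Wsh)
      (inv_nonneg.2 (Real.exp_pos (c + x)).le) Subset.rfl hBad hB0 hshB0 hshA0 hshA1 (h.weight.bad_right K t ht)
      (h.shell.right K t ht) (fun τ hτ => (hc t ht τ hτ).2)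
    simpa [hηdef] using this
  have hU : 0 < Real.exp (c + x) := Real.exp_pos _
  have htot : (1 - η) * ZB ≤ Real.exp (c + x) * ZA := by
    have h' : (1 - η) * ZB = Real.exp (c + x) * ((Real.exp (c + x))⁻¹ * (ZB - η * ZB)) := by
      rw [← mul_assoc, mul_inv_cancel₀ hU.ne', one_mul]
      ring
    rw [h']
    exact mul_le_mul_of_nonneg_left hii hU.le
  have hLU : Real.exp (c - x) = Real.exp (c + x) * Real.exp (-(2 * x)) := by
    rw [← Real.exp_add]
    congr 1
    ring
  set E := Real.exp (-(2 * x)) with hEdef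
  have hE0 : 0 < E := Real.exp_pos _
  set m := (1 - η) * E with hmdef
  have hm0 : 0 ≤ m := mul_nonneg (by linarith) hE0.le
  have hq : m * (a / ZA - η) ≤ b / ZB := by
    rw [le_div_iff₀ hZB]
    rcases le_or_gt (a - η * ZA) 0 with hneg | hpos
    · have hb0 : 0 ≤ b := sum_nonneg fun τ hτ => hB0 τ (hS hτ)
      have : a / ZA - η ≤ 0 := by
        rw [sub_nonpos, div_le_iff₀ hZA]
        linarith
      nlinarith [mul_nonneg hm0 hZB.le]
    · have hkey : m * (a / ZA - η) * ZB = ((1 - η) * ZB / ZA) * (E * (a - η * ZA)) := by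
        rw [hmdef]
        field_simp
      rw [hkey]
      calc (1 - η) * ZB / ZA * (E * (a - η * ZA))
          ≤ Real.exp (c + x) * (E * (a - η * ZA)) :=
            mul_le_mul_of_nonneg_right ((div_le_iff₀ hZA).2 htot) (mul_nonneg hE0.le hpos.le)
        _ = Real.exp (c - x) * (a - η * ZA) := by rw [hLU]; ring
        _ ≤ b := hi
  have hp1 : a / ZA ≤ 1 := by
    rw [div_le_one hZA]
    exact sum_le_sum_of_subset_of_nonneg hS fun τ hτ _ => hA0 τ hτ
  -- `p − q ≤ p − m(p − η) = p(1 − m) + mη ≤ (1 − m) + mη = 1 − m(1 − η) = 1 − (1 − η)²E`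
  have hm1 : m ≤ 1 := by
    have hE1 : E ≤ 1 := by
      rw [hEdef, Real.exp_le_one_iff]
      linarith [abs_nonneg (vol * δ K)]
    calc m = (1 - η) * E := rfl
      _ ≤ 1 * 1 := mul_le_mul (by linarith) hE1 hE0.le zero_le_one
      _ = 1 := one_mul 1
  have hfin : a / ZA - b / ZB ≤ 1 - m * (1 - η) := by
    nlinarith [mul_nonneg (sub_nonneg.2 hm1) (sub_nonneg.2 hp1)]
  calc a / ZA - b / ZB ≤ 1 - m * (1 - η) := hfin
    _ = 1 - (1 - η) ^ 2 * E := by rw [hmdef]; ring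

/-- **★ THE TV RADIUS OF A HYBRID WITNESS** [folklore].  `HybridNE7 …` with positive totals on the window ⇒ there is a radius `ρ` with `0 ≤ ρ_K < 1`,
`Σ ρ_K < ∞`, and `|Σ_S A ∕ Σ_T A − Σ_S B ∕ Σ_T B| ≤ ρ_K` for every `|t| ≤ l₀`, `S ⊆ T K` — namely `ρ_K := min (2(W_K+Wsh_K) + 2|vol·δ_K|) (1 − (1−W_K−Wsh_K)²e^{−2|vol·δ_K|})`
(p607565's summable budget capped by §1's strict bound). -/
theorem exists_tvRadius_of_hybridNE7 (h : HybridNE7 l₀ vol T A B Bad W shA shB Wsh δ)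
    (hZA : ∀ (K : ℕ) (t : ℝ), |t| ≤ l₀ → 0 < ∑ τ ∈ T K, A K t τ) (hZB : ∀ (K : ℕ) (t : ℝ), |t| ≤ l₀ → 0 < ∑ τ ∈ T K, B K t τ) :
    ∃ ρ : ℕ → ℝ, (∀ K, 0 ≤ ρ K ∧ ρ K < 1) ∧ Summable ρ ∧
      ∀ (K : ℕ) (t : ℝ), |t| ≤ l₀ → ∀ S ⊆ T K,
        |(∑ τ ∈ S, A K t τ) / (∑ τ ∈ T K, A K t τ) - (∑ τ ∈ S, B K t τ) / (∑ τ ∈ T K, B K t τ)| ≤ ρ K := by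
  set bud : ℕ → ℝ := fun K => 2 * (W K + Wsh K) + 2 * |vol * δ K| with hbud
  set str : ℕ → ℝ := fun K => 1 - (1 - (W K + Wsh K)) ^ 2 * Real.exp (-(2 * |vol * δ K|)) with hstr
  have hη0 : ∀ K, 0 ≤ W K + Wsh K := fun K => add_nonneg (h.weight.nonneg K) (h.shell.nonneg K)
  have hη1 : ∀ K, W K + Wsh K < 1 := h.lt_one
  have hbud0 : ∀ K, 0 ≤ bud K := fun K => by
    have h1 := hη0 K; have h2 := abs_nonneg (vol * δ K); simp only [hbud]; linarith
  have hstr0 : ∀ K, 0 ≤ str K := fun K => by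
    simp only [hstr]
    have h1 : (1 - (W K + Wsh K)) ^ 2 ≤ 1 := by
      have := hη0 K; have := hη1 K
      nlinarith
    have h2 : Real.exp (-(2 * |vol * δ K|)) ≤ 1 := by
      rw [Real.exp_le_one_iff]; linarith [abs_nonneg (vol * δ K)]
    nlinarith [sq_nonneg (1 - (W K + Wsh K)), (Real.exp_pos (-(2 * |vol * δ K|))).le,
      mul_le_mul h1 h2 (Real.exp_pos (-(2 * |vol * δ K|))).le zero_le_one]
  have hstr1 : ∀ K, str K < 1 := fun K => by
    simp only [hstr]
    have h1 : 0 < (1 - (W K + Wsh K)) ^ 2 := by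
      have := hη1 K
      positivity
    nlinarith [mul_pos h1 (Real.exp_pos (-(2 * |vol * δ K|)))]
  refine ⟨fun K => min (bud K) (str K), fun K => ⟨le_min (hbud0 K) (hstr0 K), (min_le_right _ _).trans_lt (hstr1 K)⟩,
    Summable.of_nonneg_of_le (fun K => le_min (hbud0 K) (hstr0 K)) (fun K => min_le_left _ _) (summable_budget_of_hybridNE7 h),
    fun K t ht S hS => le_min ?_ ?_⟩
  · exact abs_classLaw_sub_classLaw_le_of_hybridNE7 h K ht (hZA K t ht) (hZB K t ht) hS
  · rw [abs_sub_le_iff]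
    refine ⟨classLaw_sub_classLaw_le_one_sub_of_hybridNE7 h K ht (hZA K t ht) (hZB K t ht) hS, ?_⟩
    have hc := classLaw_sub_classLaw_le_one_sub_of_hybridNE7 h K ht (hZA K t ht) (hZB K t ht) (sdiff_subset (s := T K) (t := S))
    rw [sum_sdiff_eq_sub hS, sum_sdiff_eq_sub hS, sub_div, sub_div, div_self (hZA K t ht).ne', div_self (hZB K t ht).ne'] at hc
    simp only [hstr]
    linarith

end Strict

/-! ## §2 The class-law road: DECL target + summably TV-close class laws ⇒ the hybrid binder list with NO bad class and misfit shells [folklore] -/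
section Road
variable [DecidableEq ι]
/-- **★★ THE CLASS-LAW ROAD** [folklore].  Nonnegative term weights, positive totals with the E1∕E2 dictionary `Z K t = Σ_T A K t`, `Z (K+1) t = Σ_T B K t`,
node U5's DECL target `Target vol l₀ δ Z` (one constant `c_K` per level, radius `vol·δ_K`, `Σ δ < ∞`), and the two runs' normalised class laws `ρ_K`-close on
every set of classes, uniformly on `|t| ≤ l₀`, with `0 ≤ ρ_K < 1`, `Σ ρ_K < ∞` ⇒ the hybrid binder list holds with NO bad class (`Bad := ∅`, `W := 0`), shell
budget `Wsh := ρ`, core radius the target's own `δ`, and the MISFIT SHELLS `shB := (B − e^{c_K + vol·δ_K}·A)⁺`, `shA := (A − e^{vol·δ_K − c_K}·B)⁺`. -/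
theorem exists_hybridNE7_of_target_of_classLawTV (hl₀ : 0 ≤ l₀)
    (hA : ∀ (K : ℕ) (t : ℝ), |t| ≤ l₀ → ∀ τ ∈ T K, 0 ≤ A K t τ) (hB : ∀ (K : ℕ) (t : ℝ), |t| ≤ l₀ → ∀ τ ∈ T K, 0 ≤ B K t τ)
    (hZA : ∀ (K : ℕ) (t : ℝ), |t| ≤ l₀ → 0 < ∑ τ ∈ T K, A K t τ) (hZB : ∀ (K : ℕ) (t : ℝ), |t| ≤ l₀ → 0 < ∑ τ ∈ T K, B K t τ)
    {Z : ℕ → ℝ → ℝ} (hZA' : ∀ (K : ℕ) (t : ℝ), |t| ≤ l₀ → Z K t = ∑ τ ∈ T K, A K t τ)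
    (hZB' : ∀ (K : ℕ) (t : ℝ), |t| ≤ l₀ → Z (K + 1) t = ∑ τ ∈ T K, B K t τ) (hT : Target vol l₀ δ Z)
    {ρ : ℕ → ℝ} (hρ0 : ∀ K, 0 ≤ ρ K) (hρ1 : ∀ K, ρ K < 1) (hρs : Summable ρ)
    (hρ : ∀ (K : ℕ) (t : ℝ), |t| ≤ l₀ → ∀ S ⊆ T K,
      |(∑ τ ∈ S, A K t τ) / (∑ τ ∈ T K, A K t τ) - (∑ τ ∈ S, B K t τ) / (∑ τ ∈ T K, B K t τ)| ≤ ρ K) :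
    ∃ shA shB : ℕ → ℝ → ι → ℝ, HybridNE7 l₀ vol T A B (fun _ _ => ∅) (fun _ => 0) shA shB ρ δ := by
  obtain ⟨hM, hδ⟩ := hT
  choose c hc using hM
  -- the target's radius is nonnegative (read at `t = 0`)
  have hr0 : ∀ K, 0 ≤ vol * δ K := fun K => (abs_nonneg _).trans (hc K 0 (by simpa using hl₀))
  -- the two constants of the target dominate the mass ratio from both sides
  have hratB : ∀ (K : ℕ) (t : ℝ), |t| ≤ l₀ →
      (∑ τ ∈ T K, B K t τ) / (∑ τ ∈ T K, A K t τ) ≤ Real.exp (c K + vol * δ K) := fun K t ht => by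
    have h1 := (abs_le.1 (hc K t ht)).2
    rw [hZA' K t ht, hZB' K t ht] at h1
    have : (∑ τ ∈ T K, B K t τ) / (∑ τ ∈ T K, A K t τ) =
        Real.exp (Real.log (∑ τ ∈ T K, B K t τ) - Real.log (∑ τ ∈ T K, A K t τ)) := by
      rw [Real.exp_sub, Real.exp_log (hZB K t ht), Real.exp_log (hZA K t ht)]
    rw [this, Real.exp_le_exp]
    linarith
  have hratA : ∀ (K : ℕ) (t : ℝ), |t| ≤ l₀ →
      (∑ τ ∈ T K, A K t τ) / (∑ τ ∈ T K, B K t τ) ≤ Real.exp (vol * δ K - c K) := fun K t ht => by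
    have h1 := (abs_le.1 (hc K t ht)).1
    rw [hZA' K t ht, hZB' K t ht] at h1
    have : (∑ τ ∈ T K, A K t τ) / (∑ τ ∈ T K, B K t τ) =
        Real.exp (Real.log (∑ τ ∈ T K, A K t τ) - Real.log (∑ τ ∈ T K, B K t τ)) := by
      rw [Real.exp_sub, Real.exp_log (hZB K t ht), Real.exp_log (hZA K t ht)]
    rw [this, Real.exp_le_exp]
    linarith
  refine ⟨fun K t τ => if Real.exp (vol * δ K - c K) * B K t τ < A K t τ then A K t τ - Real.exp (vol * δ K - c K) * B K t τ else 0,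
    fun K t τ => if Real.exp (c K + vol * δ K) * A K t τ < B K t τ then B K t τ - Real.exp (c K + vol * δ K) * A K t τ else 0, ?_⟩
  refine
    { weight :=
        { bad_subset := fun K t _ => empty_subset _
          nonneg := fun _ => le_rfl
          lt_one := fun _ => zero_lt_one
          summable := summable_zero
          bad_left := fun K t _ => by simp
          bad_right := fun K t _ => by simp }
      shell :=
        { nonneg := hρ0
          summable := hρs
          sh_nonneg_left := fun K t ht τ hτ => by
            split_ifs with h1
            · linarith
            · exact le_rfl
          sh_le_left := fun K t ht τ hτ => by
            split_ifs with h1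
            · linarith [mul_nonneg (Real.exp_pos (vol * δ K - c K)).le (hB K t ht τ hτ)]
            · exact hA K t ht τ hτ
          sh_nonneg_right := fun K t ht τ hτ => by
            split_ifs with h1
            · linarith
            · exact le_rfl
          sh_le_right := fun K t ht τ hτ => by
            split_ifs with h1
            · linarith [mul_nonneg (Real.exp_pos (c K + vol * δ K)).le (hA K t ht τ hτ)]
            · exact hB K t ht τ hτ
          left := fun K t ht => ?_
          right := fun K t ht => ?_ }
      lt_one := fun K => by simpa using hρ1 K
      summable := hδ
      core := fun K => ⟨c K, fun t ht τ hτ => ?_⟩ }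
  · -- run A: `Σ_T shA = Σ_{S⁻}(A − e^{r−c}B) ≤ Σ_{S⁻}A − (Z_A∕Z_B)·Σ_{S⁻}B = Z_A·(p(S⁻) − q(S⁻)) ≤ ρ_K·Z_A`
    set w := Real.exp (vol * δ K - c K) with hw
    set Sm := (T K).filter (fun τ => w * B K t τ < A K t τ) with hSm
    have hSmT : Sm ⊆ T K := filter_subset _ _
    have hsum : ∑ τ ∈ T K, (if w * B K t τ < A K t τ then A K t τ - w * B K t τ else 0) =
        ∑ τ ∈ Sm, (A K t τ - w * B K t τ) := (sum_filter _ _).symm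
    rw [hsum, sum_sub_distrib, ← mul_sum]
    have hB0 : 0 ≤ ∑ τ ∈ Sm, B K t τ := sum_nonneg fun τ hτ => hB K t ht τ (hSmT hτ)
    have hZAp := hZA K t ht
    have hZBp := hZB K t ht
    have htv := (abs_sub_le_iff.1 (hρ K t ht Sm hSmT)).1
    rw [sub_le_iff_le_add, div_le_iff₀ hZAp] at htv
    have hw' : (∑ τ ∈ T K, A K t τ) / (∑ τ ∈ T K, B K t τ) ≤ w := hratA K t ht
    calc ∑ τ ∈ Sm, A K t τ - w * ∑ τ ∈ Sm, B K t τ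
        ≤ ∑ τ ∈ Sm, A K t τ - (∑ τ ∈ T K, A K t τ) / (∑ τ ∈ T K, B K t τ) * ∑ τ ∈ Sm, B K t τ := by
          nlinarith [mul_le_mul_of_nonneg_right hw' hB0]
      _ ≤ ρ K * ∑ τ ∈ T K, A K t τ := by
          have : (∑ τ ∈ T K, A K t τ) / (∑ τ ∈ T K, B K t τ) * ∑ τ ∈ Sm, B K t τ =
              (∑ τ ∈ Sm, B K t τ) / (∑ τ ∈ T K, B K t τ) * ∑ τ ∈ T K, A K t τ := by
            field_simp
          rw [this]
          nlinarith
  · -- run B: `Σ_T shB = Σ_{S⁺}(B − e^{c+r}A) ≤ Σ_{S⁺}B − (Z_B∕Z_A)·Σ_{S⁺}A = Z_B·(q(S⁺) − p(S⁺)) ≤ ρ_K·Z_B`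
    set u := Real.exp (c K + vol * δ K) with hu
    set Sp := (T K).filter (fun τ => u * A K t τ < B K t τ) with hSp
    have hSpT : Sp ⊆ T K := filter_subset _ _
    have hsum : ∑ τ ∈ T K, (if u * A K t τ < B K t τ then B K t τ - u * A K t τ else 0) =
        ∑ τ ∈ Sp, (B K t τ - u * A K t τ) := (sum_filter _ _).symm
    rw [hsum, sum_sub_distrib, ← mul_sum]
    have hA0 : 0 ≤ ∑ τ ∈ Sp, A K t τ := sum_nonneg fun τ hτ => hA K t ht τ (hSpT hτ)
    have hZAp := hZA K t ht
    have hZBp := hZB K t ht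
    have htv := (abs_sub_le_iff.1 (hρ K t ht Sp hSpT)).2
    rw [sub_le_iff_le_add, div_le_iff₀ hZBp] at htv
    have hu' : (∑ τ ∈ T K, B K t τ) / (∑ τ ∈ T K, A K t τ) ≤ u := hratB K t ht
    calc ∑ τ ∈ Sp, B K t τ - u * ∑ τ ∈ Sp, A K t τ
        ≤ ∑ τ ∈ Sp, B K t τ - (∑ τ ∈ T K, B K t τ) / (∑ τ ∈ T K, A K t τ) * ∑ τ ∈ Sp, A K t τ := by
          nlinarith [mul_le_mul_of_nonneg_right hu' hA0]
      _ ≤ ρ K * ∑ τ ∈ T K, B K t τ := by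
          have : (∑ τ ∈ T K, B K t τ) / (∑ τ ∈ T K, A K t τ) * ∑ τ ∈ Sp, A K t τ =
              (∑ τ ∈ Sp, A K t τ) / (∑ τ ∈ T K, A K t τ) * ∑ τ ∈ T K, B K t τ := by
            field_simp
          rw [this]
          nlinarith
  · -- the core sandwich BY CONSTRUCTION of the misfit shells (three cases)
    have hτT : τ ∈ T K := by simpa using hτ
    set a := A K t τ with ha
    set b := B K t τ with hb
    set u := Real.exp (c K + vol * δ K) with hu
    set l := Real.exp (c K - vol * δ K) with hl
    set w := Real.exp (vol * δ K - c K) with hw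
    have ha0 : 0 ≤ a := hA K t ht τ hτT
    have hb0 : 0 ≤ b := hB K t ht τ hτT
    have hu0 : 0 < u := Real.exp_pos _
    have hl0 : 0 < l := Real.exp_pos _
    have hw0 : 0 < w := Real.exp_pos _
    have hlu : l ≤ u := Real.exp_le_exp.2 (by linarith [hr0 K])
    have hlw : l * w = 1 := by rw [hl, hw, ← Real.exp_add]; simp
    have huw : 1 ≤ u * w := by rw [hu, hw, ← Real.exp_add, ← Real.exp_zero, Real.exp_le_exp]; linarith [hr0 K]
    by_cases h1 : u * a < b
    · -- run B over the upper line: `shB = b − u a`, `shA = 0`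
      have h2 : ¬ (w * b < a) := by
        intro h2
        have : u * w * a < b * w := by nlinarith
        nlinarith
      rw [if_pos h1, if_neg h2]
      constructor <;> nlinarith
    · by_cases h2 : w * b < a
      · -- run A over the lower line: `shA = a − w b`, `shB = 0`
        rw [if_neg h1, if_pos h2]
        refine ⟨?_, ?_⟩
        · have : l * (a - (a - w * b)) = (l * w) * b := by ring
          rw [this, hlw, one_mul]
          linarith
        · have : u * (a - (a - w * b)) = (u * w) * b := by ring
          rw [this]
          nlinarith
      · -- inside the band: no shells
        rw [if_neg h1, if_neg h2]
        push Not at h1 h2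
        refine ⟨?_, by linarith⟩
        calc l * (a - 0) = l * a := by ring
          _ ≤ l * (w * b) := mul_le_mul_of_nonneg_left h2 hl0.le
          _ = (l * w) * b - 0 := by ring
          _ = b - 0 := by rw [hlw, one_mul]

end Road

/-! ## §3 The characterisation [folklore] -/
section Iff
variable [DecidableEq ι]
/-- **★★★ THE ALL-DIALS CHARACTERISATION OF THE HYBRID BINDER LIST AT A KEY** [folklore].  For nonnegative term weights with positive totals on the source
window and the E1∕E2 dictionary (`0 < vol`, `0 ≤ l₀`):
`(∃ Bad W shA shB Wsh δ, HybridNE7 l₀ vol T A B Bad W shA shB Wsh δ) ↔ (∃ δ, Target vol l₀ δ Z) ∧ ∃ ρ, (∀ K, 0 ≤ ρ_K ∧ ρ_K < 1) ∧ Summable ρ ∧`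
`∀ K t, |t| ≤ l₀ → ∀ S ⊆ T K, |Σ_S A ∕ Σ_T A − Σ_S B ∕ Σ_T B| ≤ ρ_K` — node U5's DECL target plus ONE summable total-variation letter on the two runs' class
LAWS is exactly what the three hybrid faces (NE7b bad-class weights, NE7c shells, the NE7 core edge) are worth when every dial is the prover's.  (→ : the tree's
`target_of_hybridNE7` with remainder `hybridDelta vol δ (W + Wsh)`, and §1; ← : §2's road with `Bad := ∅`.)  dag-n19-w1's `coreEdge_iff_target_classOsc`
(p602850 §4) is the fixed-weights shadow with the sup-norm letter `Hom`. -/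
theorem exists_hybridNE7_iff_target_and_classLawTV (hvol : 0 < vol) (hl₀ : 0 ≤ l₀)
    (hA : ∀ (K : ℕ) (t : ℝ), |t| ≤ l₀ → ∀ τ ∈ T K, 0 ≤ A K t τ) (hB : ∀ (K : ℕ) (t : ℝ), |t| ≤ l₀ → ∀ τ ∈ T K, 0 ≤ B K t τ)
    (hZA : ∀ (K : ℕ) (t : ℝ), |t| ≤ l₀ → 0 < ∑ τ ∈ T K, A K t τ) (hZB : ∀ (K : ℕ) (t : ℝ), |t| ≤ l₀ → 0 < ∑ τ ∈ T K, B K t τ)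
    {Z : ℕ → ℝ → ℝ} (hZA' : ∀ (K : ℕ) (t : ℝ), |t| ≤ l₀ → Z K t = ∑ τ ∈ T K, A K t τ)
    (hZB' : ∀ (K : ℕ) (t : ℝ), |t| ≤ l₀ → Z (K + 1) t = ∑ τ ∈ T K, B K t τ) :
    (∃ (Bad : ℕ → ℝ → Finset ι) (W : ℕ → ℝ) (shA shB : ℕ → ℝ → ι → ℝ) (Wsh δ : ℕ → ℝ), HybridNE7 l₀ vol T A B Bad W shA shB Wsh δ) ↔
      ((∃ δ : ℕ → ℝ, Target vol l₀ δ Z) ∧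
        ∃ ρ : ℕ → ℝ, (∀ K, 0 ≤ ρ K ∧ ρ K < 1) ∧ Summable ρ ∧
          ∀ (K : ℕ) (t : ℝ), |t| ≤ l₀ → ∀ S ⊆ T K,
            |(∑ τ ∈ S, A K t τ) / (∑ τ ∈ T K, A K t τ) - (∑ τ ∈ S, B K t τ) / (∑ τ ∈ T K, B K t τ)| ≤ ρ K) := by
  constructor
  · rintro ⟨Bad, W, shA, shB, Wsh, δ, h⟩
    exact ⟨⟨hybridDelta vol δ fun K => W K + Wsh K, target_of_hybridNE7 h hvol hl₀ hZA' hZB' hZA⟩,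
      exists_tvRadius_of_hybridNE7 h hZA hZB⟩
  · rintro ⟨⟨δ, hT⟩, ρ, hρ01, hρs, hρ⟩
    obtain ⟨shA, shB, h⟩ := exists_hybridNE7_of_target_of_classLawTV hl₀ hA hB hZA hZB hZA' hZB' hT
      (fun K => (hρ01 K).1) (fun K => (hρ01 K).2) hρs hρ
    exact ⟨_, _, shA, shB, ρ, δ, h⟩

/-- COROLLARY (the road's by-product): with the dictionary, whenever SOME choice of the six dials gives `HybridNE7`, a choice with NO bad class does
(`Bad := ∅`, `W := 0`) — at a pinned key N20's bad-class dial is redundant given N21's shells (dag-n19-w1's `…N19CutTransferAtSpineReading` fold, here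
re-derived through the class laws). [folklore] -/
theorem exists_hybridNE7_noBad_of_exists_hybridNE7 (hvol : 0 < vol) (hl₀ : 0 ≤ l₀)
    (hA : ∀ (K : ℕ) (t : ℝ), |t| ≤ l₀ → ∀ τ ∈ T K, 0 ≤ A K t τ) (hB : ∀ (K : ℕ) (t : ℝ), |t| ≤ l₀ → ∀ τ ∈ T K, 0 ≤ B K t τ)
    (hZA : ∀ (K : ℕ) (t : ℝ), |t| ≤ l₀ → 0 < ∑ τ ∈ T K, A K t τ) (hZB : ∀ (K : ℕ) (t : ℝ), |t| ≤ l₀ → 0 < ∑ τ ∈ T K, B K t τ)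
    {Z : ℕ → ℝ → ℝ} (hZA' : ∀ (K : ℕ) (t : ℝ), |t| ≤ l₀ → Z K t = ∑ τ ∈ T K, A K t τ)
    (hZB' : ∀ (K : ℕ) (t : ℝ), |t| ≤ l₀ → Z (K + 1) t = ∑ τ ∈ T K, B K t τ)
    (h : ∃ (Bad : ℕ → ℝ → Finset ι) (W : ℕ → ℝ) (shA shB : ℕ → ℝ → ι → ℝ) (Wsh δ : ℕ → ℝ), HybridNE7 l₀ vol T A B Bad W shA shB Wsh δ) :
    ∃ (shA shB : ℕ → ℝ → ι → ℝ) (Wsh δ : ℕ → ℝ), HybridNE7 l₀ vol T A B (fun _ _ => ∅) (fun _ => 0) shA shB Wsh δ := by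
  obtain ⟨⟨δ, hT⟩, ρ, hρ01, hρs, hρ⟩ := (exists_hybridNE7_iff_target_and_classLawTV hvol hl₀ hA hB hZA hZB hZA' hZB').1 h
  obtain ⟨shA, shB, h'⟩ := exists_hybridNE7_of_target_of_classLawTV hl₀ hA hB hZA hZB hZA' hZB' hT
    (fun K => (hρ01 K).1) (fun K => (hρ01 K).2) hρs hρ
  exact ⟨shA, shB, ρ, δ, h'⟩

end Iff

end Summit.QuantumFields.YangMills.BalabanUVNodes.N20HybridClassLawCharacterisation

end
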